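import Mathlib
import HarnessLib.Audit
import Summits.PneNP.PneNP.Theorems.PstarRankRigidityTwo
import Summits.PneNP.PneNP.Theorems.PstarEdgeRankTwo

/-!
# Literal edges: an edge sum in the ideal of a NOR flat meets the literals (ROUND-24, memo `CORE-BOUND-NOTES.md` §4 / §10 R7(iii) / O5)

FRONTIER range-avoidance ladder, rung F-N3, ROUND 24 (cell `pnp-ideate`, planner memo `r24/CORE-BOUND-NOTES.md` §4 ("every path monomial
contains `σ` or `τ`"), §10 R7(iii) and O5 (composite literal classes); restricted-model proof complexity — nothing here bears on `P` versus `NP`).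

After the forcing dichotomy (`PstarForcing.forcing_cases`, case (NOR)) a forced chord `e` has path form
`Q_{P_e} = μ₁ m₁ + μ₂ m₂ + κ` with `μ₁, μ₂` (the literals) and `m₁, m₂` affine.  For an EDGE SUM `Q = Σ_{(p,q) ∈ T} a_p a_q` of a simple
graph `T` this pins down the combinatorics:

* `edge_meets_support` — every edge of `T` has an endpoint in the support of the linear part of `μ₁` or of `μ₂` (compare polar forms at
  `(e_p, e_q)`: the polar form of `μ m` is `ℓ_μ ⊗ ℓ_m + ℓ_m ⊗ ℓ_μ`, which vanishes at two basis vectors outside `supp ℓ_μ`, while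
  `B_T(e_p, e_q) = [p ~ q]`, `PstarEdgeRankTwo.polar_single_single`);
* `edge_meets_literals` — SINGLE LITERALS `μ₁ = a_σ`, `μ₂ = a_τ`: every edge of `T` contains `σ` or `τ` (memo §4: "every path monomial
  contains `σ` or `τ`", the algebraic input of the NOR structure R8; with simple overlaps consecutive path edges then alternate `σ/τ`);
* `no_edge_of_const` — degenerate case: an edge sum that is affine (`μ₁ = μ₂ = 0`) has no edges.
-/

set_option linter.dupNamespace false -- `Summit.PneNP.PneNP.…`: summit = sub-problem name (D-0017 single-conjunct layout)

open Finset Module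
open Summit.PneNP.PneNP.Theorems.PstarCubeIdeals (IsAffineFn isAffineFn_const)
open Summit.PneNP.PneNP.Theorems.PstarRankRigidityTwo (linPart symForm symForm_apply linPart_apply affine_mul_polar)
open Summit.PneNP.PneNP.Theorems.PstarProductRank (qform polar qform_add)
open Summit.PneNP.PneNP.Theorems.PstarGraphQuadGap (Edge Simple)
open Summit.PneNP.PneNP.Theorems.PstarEdgeRankTwo (polar_single_single)

namespace Summit.PneNP.PneNP.Theorems.PstarLiteralEdges

/-- In `𝔽₂`, `x + x = 0`. -/
private theorem zmod2_add_self (x : ZMod 2) : x + x = 0 := by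
  revert x; decide

variable {V : ℕ}

/-- The polar form of `μ₁ m₁ + μ₂ m₂ + κ` (all affine) vanishes at a pair of vectors on which the linear parts of `μ₁` and `μ₂` both vanish. -/
theorem polar_eq_zero_of_linParts {N : Type*} [AddCommGroup N] [Module (ZMod 2) N] {Q μ₁ μ₂ m₁ m₂ : N → ZMod 2}
    (h₁ : IsAffineFn μ₁) (h₂ : IsAffineFn μ₂) (hm₁ : IsAffineFn m₁) (hm₂ : IsAffineFn m₂) {κ : ZMod 2}
    (hQ : ∀ x, Q x = μ₁ x * m₁ x + μ₂ x * m₂ x + κ) {v w : N}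
    (hv₁ : μ₁ v = μ₁ 0) (hw₁ : μ₁ w = μ₁ 0) (hv₂ : μ₂ v = μ₂ 0) (hw₂ : μ₂ w = μ₂ 0) :
    Q (v + w) + Q v + Q w + Q 0 = 0 := by
  rw [hQ, hQ, hQ, hQ, affine_mul_polar h₁ hm₁, affine_mul_polar h₂ hm₂]
  simp only [symForm_apply, linPart_apply]
  rw [hv₁, hw₁, hv₂, hw₂]
  generalize μ₁ 0 = a; generalize μ₂ 0 = b
  generalize m₁ v = c; generalize m₁ w = c'; generalize m₁ 0 = c₀
  generalize m₂ v = d; generalize m₂ w = d'; generalize m₂ 0 = d₀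
  generalize κ = k
  revert a b c c' c₀ d d' d₀ k; decide

/-- **Every edge meets the literal supports.**  If the edge sum of a simple graph `T` equals `μ₁ m₁ + μ₂ m₂ + κ` with all four factors affine,
then every edge of `T` has an endpoint `v` with `ℓ_{μ₁}(e_v) ≠ 0` or `ℓ_{μ₂}(e_v) ≠ 0` (`ℓ_μ(e_v) = μ(e_v) + μ(0)`). -/
theorem edge_meets_support {T : Finset (Edge V)} (hS : Simple T) {μ₁ μ₂ m₁ m₂ : (Fin V → ZMod 2) → ZMod 2}
    (h₁ : IsAffineFn μ₁) (h₂ : IsAffineFn μ₂) (hm₁ : IsAffineFn m₁) (hm₂ : IsAffineFn m₂) {κ : ZMod 2}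
    (hQ : ∀ a, qform T Prod.fst Prod.snd a = μ₁ a * m₁ a + μ₂ a * m₂ a + κ) {e : Edge V} (he : e ∈ T) :
    (μ₁ (Pi.single e.1 1) ≠ μ₁ 0 ∨ μ₂ (Pi.single e.1 1) ≠ μ₂ 0) ∨ (μ₁ (Pi.single e.2 1) ≠ μ₁ 0 ∨ μ₂ (Pi.single e.2 1) ≠ μ₂ 0) := by
  classical
  by_contra hno
  push Not at hno
  obtain ⟨⟨hv₁, hv₂⟩, hw₁, hw₂⟩ := hno
  have h0 := polar_eq_zero_of_linParts h₁ h₂ hm₁ hm₂ hQ hv₁ hw₁ hv₂ hw₂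
  -- but the polar form of the edge sum at `(e_{e.1}, e_{e.2})` is `1`
  have h1 : qform T Prod.fst Prod.snd ((Pi.single e.1 1 : Fin V → ZMod 2) + Pi.single e.2 1) +
      qform T Prod.fst Prod.snd (Pi.single e.1 1 : Fin V → ZMod 2) + qform T Prod.fst Prod.snd (Pi.single e.2 1 : Fin V → ZMod 2) +
      qform T Prod.fst Prod.snd (0 : Fin V → ZMod 2) = 1 := by
    have hz : qform T Prod.fst Prod.snd (0 : Fin V → ZMod 2) = 0 := by
      simp only [qform, Pi.zero_apply, mul_zero, sum_const_zero]
    rw [qform_add, hz, add_zero, polar_single_single hS, if_pos (Or.inl (show (e.1, e.2) ∈ T from he))]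
    generalize qform T Prod.fst Prod.snd (Pi.single e.1 1 : Fin V → ZMod 2) = s
    generalize qform T Prod.fst Prod.snd (Pi.single e.2 1 : Fin V → ZMod 2) = s'
    revert s s'; decide
  rw [h0] at h1
  exact zero_ne_one h1

/-- **Single literals: every edge contains `σ` or `τ`** (memo §4).  If `Σ_{(p,q)∈T} a_p a_q = a_σ · m₁(a) + a_τ · m₂(a) + κ` with `m₁, m₂`
affine, then every edge of `T` has `σ` or `τ` as an endpoint. -/
theorem edge_meets_literals {T : Finset (Edge V)} (hS : Simple T) {σ τ : Fin V} {m₁ m₂ : (Fin V → ZMod 2) → ZMod 2}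
    (hm₁ : IsAffineFn m₁) (hm₂ : IsAffineFn m₂) {κ : ZMod 2} (hQ : ∀ a, qform T Prod.fst Prod.snd a = a σ * m₁ a + a τ * m₂ a + κ)
    {e : Edge V} (he : e ∈ T) : e.1 = σ ∨ e.1 = τ ∨ e.2 = σ ∨ e.2 = τ := by
  classical
  have hlin : ∀ ρ : Fin V, IsAffineFn (fun a : Fin V → ZMod 2 => a ρ) := fun ρ x w => by
    simp only [Pi.add_apply, Pi.zero_apply, add_zero]
  have h := edge_meets_support hS (hlin σ) (hlin τ) hm₁ hm₂ hQ he
  simp only [Pi.single_apply, Pi.zero_apply, ne_eq] at h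
  -- `e_v(ρ) ≠ 0` means `v = ρ`
  rcases h with (h | h) | (h | h)
  · by_cases hc : e.1 = σ
    · exact Or.inl hc
    · exact absurd (by rw [if_neg (Ne.symm hc)]) h
  · by_cases hc : e.1 = τ
    · exact Or.inr (Or.inl hc)
    · exact absurd (by rw [if_neg (Ne.symm hc)]) h
  · by_cases hc : e.2 = σ
    · exact Or.inr (Or.inr (Or.inl hc))
    · exact absurd (by rw [if_neg (Ne.symm hc)]) h
  · by_cases hc : e.2 = τ
    · exact Or.inr (Or.inr (Or.inr hc))
    · exact absurd (by rw [if_neg (Ne.symm hc)]) h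

/-- **An affine edge sum has no edges.** -/
theorem no_edge_of_const {T : Finset (Edge V)} (hS : Simple T) {m : (Fin V → ZMod 2) → ZMod 2} (hm : IsAffineFn m)
    (hQ : ∀ a, qform T Prod.fst Prod.snd a = m a) : T = ∅ := by
  classical
  refine eq_empty_of_forall_notMem fun e he => ?_
  have h := edge_meets_support hS (isAffineFn_const (M := Fin V → ZMod 2) 1) (isAffineFn_const (M := Fin V → ZMod 2) 0) hm hm
    (κ := 0) (fun a => by show qform T Prod.fst Prod.snd a = 1 * m a + 0 * m a + 0; rw [hQ, one_mul, zero_mul, add_zero, add_zero]) he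
  simp at h

end Summit.PneNP.PneNP.Theorems.PstarLiteralEdges
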